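import Summits.NavierStokesRegularity.NavierStokesRegularity.Theorems.ScenarioCensusRowF1SharpTopDom
import Summits.NavierStokesRegularity.NavierStokesRegularity.Theorems.ScenarioCensusRowF1SharpTopCrit
import Summits.NavierStokesRegularity.NavierStokesRegularity.Theorems.ScenarioCensusRowF1SocketTop
import HarnessLib

/-!
# LINE 28 «sharp-top» port, part 4/4: §12 (end) antitonicity of the cross-flow number in the level (`xflIntegrand_anti`); §13 the sharp cross-flow row `Row_F1xfS` / `rowF1xfS_holds`, its floor `DivergentSharpCrossFlow`, the residual `SharpSlack` (≡ `Row_F1`),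
# `rowF1xf_of_rowF1xfS`, pointwise corners; census KEYS `Row_F1xfS` + `_excluded`, floor DSX, edge F1xf♯ ⇒ F1xf

Re-homed for the scenario census (typer seat ns-census-typer-1 g9; the cell F1xf♯ and the floor DSX are MEMBERS OF RECORD «DECIDED IN KERNEL IN FILES» of row F1 since
census v1.81 (critic idea-crit-3 g8 PASS 04:49Z — no price; ref ns-census-ref g11 PRE-CHECK ✓ §16.4 item 49; lead-presearch label); this port makes them TREE-decided):
VERBATIM PORT of the NEW sections (§8♯, §12, §13) of ns-idea-3 LINE 28 «sharp-top», `pub/ideators/ns-idea-3/lines/sharp-top/line-sharp-top.lean` sha16 3f3b055f6f2a207c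
(2536 l., lean check rc 0, 0 sorry; its §1–§5 / §8 / §9–§11 = LINE 27 «liouville-socket» 01bcb6dd501a8321 byte-identical — 106/106 declarations, taken BY NAME from
`ScenarioCensusRowF1Socket*`), split for the 400-line rule into `ScenarioCensusRowF1SharpTop` (§8♯) → `…SharpTopDom` (§12) → `…SharpTopCrit` (§12 end: the critical level as a speed threshold) → `…SharpTopRow` (§13 + census KEYS); each part imports only the parts it uses.  Lean text VERBATIM in
namespace `…Theorems.ScenarioCensus.SharpTop` (the line's `…Cruxes.ScenarioCensusRowF1.SharpTopLine` re-homed) with `open …ScenarioCensus.LiouvilleSocket`; port edits: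
the bracket lines `section IntegralTransferCrit` / `end …` dropped (no `variable`s), `@[conjecture]` on the residual `SharpSlack` (≡ `ScenarioCensus.Row_F1`, OPEN),
one-line docstrings added where missing (gate lint); `norm_cross_le` is the Literature lemma `norm_cross_le_mul_norm` taken BY NAME and the display `rowF1xf_holds'` (a second proof term of LINE 27's row) is not re-declared.  Statements untouched.

No census VALUE is moved here (row F1 stays OPEN-WITH-LINE; the member becomes TREE-decided by name); NS regularity is NOT proved; `Row_F1` is untouched (zero
movement, `sharpSlack_iff_rowF1`); no summit statement is proved by this file. Lemmas that restate already-landed tree declarations are taken BY NAME (gate lint `dedup.landed`): `fderiv_smul_stPull_apply` = `InviscidTop.fderiv_smul_stPull_apply`, `fderiv_smul_stPull` = `InviscidTop.fderiv_smul_stPull`, `fderiv_fderiv_smul_stPull` = `InviscidTop.fderiv_fderiv_smul_stPull`, `tendsto_clm_of_tendsto_apply` = `InviscidTop.tendsto_clm_of_tendsto_apply`, `tendsto_fderiv_fderiv_apply_of_bound` = `InviscidTop.tendsto_fderiv_fderiv_apply_of_bound`, `tendsto_fderiv_fderiv_of_bound` = `InviscidTop.tendsto_fderiv_fderiv_of_bound`,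 `tendsto_fderiv_fderiv_of_typeI_seq_Ioo` = `InviscidTop.tendsto_fderiv_fderiv_of_typeI_seq_Ioo`, `fderiv3_smul_stPull` = `FrozenTop.fderiv3_smul_stPull`, `tendsto_fderiv3_of_typeI_seq_Ioo` = `FrozenTop.tendsto_fderiv3_of_typeI_seq_Ioo`, `tendsto_physicalTime` = `ColumnarTop.tendsto_physicalTime`, `eventually_fast` = `ColumnarTop.eventually_fast`, `sqrt_timeLag` = `StretchedTop.sqrt_timeLag`, `forall_of_forall_ne_zero` = `StretchedTop.forall_of_forall_ne_zero`, `radius_eq` = `FrozenTop.radius_eq`, `jointCond_everywhere₆` = `FrozenTop.jointCond_everywhere₄`, `continuousOn_quad` = `IntegratedStretch.continuousOn_quad`, `sqrt_nu_timeLag` = `IntegratedStretch.sqrt_nu_timeLag`, `sing_of_not_bounded` = `InviscidTop.sing_of_not_bounded`, `exists_singularZoom_package₃` = `FrozenTop.exists_singularZoom_package₃`, `lapD_eq_zero_of_eq_zero` = `FrozenTop.lapD_eq_zero_of_eq_zero`, `measurableSet_top` = `IntegratedStretch.measurableSet_top`, `norm_cross_le` = `norm_cross_le_mul_norm`.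
-/

-- the summit and its single problem share the name `NavierStokesRegularity` (D-0017 nested layout)
set_option linter.dupNamespace false

noncomputable section

open MeasureTheory Set Function Filter TopologicalSpace Metric
open scoped Topology NNReal ENNReal InnerProductSpace RealInnerProductSpace Laplacian

namespace Summit.NavierStokesRegularity.NavierStokesRegularity.Theorems.ScenarioCensus.SharpTop

open Literature.Analysis Literature.Analysis.FluidPDE
open Summit.NavierStokesRegularity.NavierStokesRegularity.Theorems
open Summit.NavierStokesRegularity.NavierStokesRegularity.Theorems.ScenarioCensus.LiouvilleSocket

/-- The cross-flow integrand is ANTITONE jointly in the fraction `κ` and in the level (a larger allowance and a higher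
level both charge less). -/
theorem xflIntegrand_anti {κ₁ κ₂ : ℝ} (hκ : κ₁ ≤ κ₂) {T ν : ℝ} (hν : 0 ≤ ν) {Λ₁ Λ₂ : ℝ → ℝ}
    (hΛ : ∀ t < T, Λ₁ t ≤ Λ₂ t) (t₀ : ℝ) (u : ℝ → E3 → E3) (z : ℝ × E3) :
    xflIntegrand T ν κ₂ t₀ Λ₂ u z ≤ xflIntegrand T ν κ₁ t₀ Λ₁ u z := by
  unfold xflIntegrand
  by_cases hz : z ∈ {z : ℝ × E3 | z.1 ∈ Ico t₀ T ∧ Λ₂ z.1 < ‖u z.1 z.2‖}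
  · have hz' : z ∈ {z : ℝ × E3 | z.1 ∈ Ico t₀ T ∧ Λ₁ z.1 < ‖u z.1 z.2‖} :=
      ⟨hz.1, (hΛ z.1 hz.1.2).trans_lt hz.2⟩
    rw [indicator_of_mem hz, indicator_of_mem hz']
    have hσ : 0 < T - z.1 := sub_pos.2 hz.1.2
    refine ENNReal.ofReal_le_ofReal (mul_le_mul_of_nonneg_left (max_le_max le_rfl ?_) (Real.sqrt_nonneg _))
    have h0 : 0 ≤ ν * (T - z.1)⁻¹ * ‖curl (u z.1) z.2‖ ^ 2 :=
      mul_nonneg (mul_nonneg hν (inv_nonneg.2 hσ.le)) (sq_nonneg _)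
    nlinarith
  · rw [indicator_of_notMem hz]
    exact bot_le

/-! ### §13 THE SHARP CROSS-FLOW ROW F1xf♯, its floor, its residual ≡ `Row_F1`, and F1xf♯ ⇒ F1xf -/

/-- The **sharp cross-flow number**: LINE 27's cross-flow excess integrand charged only on the CRITICAL fast set
`{(t, x) ∈ [t₀, T) × ℝ³ : Λ♯_κ(t) < |u(t, x)|} = {κν/(T − t) < |u|²}` (`critLevel_lt_norm_iff`):
`𝔛♯_κ(t₀) = ∬_{[t₀,T) × {|u|² > κν/(T−t)}} √(T − t) [‖ω × u‖² − κ ν |ω|²/(T − t)]₊ dx dt`. -/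
def xfsIntegrand (T ν κ t₀ : ℝ) (u : ℝ → E3 → E3) : ℝ × E3 → ℝ≥0∞ :=
  xflIntegrand T ν κ t₀ (critLevel T ν κ) u

/-- **Criterion row F1xf♯ (SHARP CROSS-FLOW ROW)**: the exact frame of `Row_F1` plus ONE hypothesis — for some `κ < 1`
and some `t₀ ∈ [0, T)`, `𝔛♯_κ(t₀) < ∞`: the cross-flow excess over `√κ` times the self-similar rate is integrable ON THE
SET WHERE THE SPEED ITSELF EXCEEDS `√κ` TIMES THE SELF-SIMILAR SPEED (no level function, no subcriticality, nothing charged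
at slower points).  PROVED (`rowF1xfS_holds`); implies LINE 27's row F1xf (`rowF1xf_of_rowF1xfS`). -/
def Row_F1xfS : Prop :=
  ∀ (ν T : ℝ), 0 < ν → 0 < T → ∀ (u : ℝ → E3 → E3) (p : ℝ → E3 → ℝ),
    IsClassicalNSSolutionOn (Ico 0 T) ν 0 u p → IsLerayHopfOn T ν 0 (u 0) u →
    HasRapidSpatialDecay (u 0) → IsTypeIBlowup u T →
    (∃ κ t₀ : ℝ, κ < 1 ∧ 0 ≤ t₀ ∧ t₀ < T ∧ ∫⁻ z, xfsIntegrand T ν κ t₀ u z < ⊤) →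
    HasSmoothExtensionPast ν 0 u T

/-- **DIVERGENT SHARP CROSS-FLOW** (structural floor, maximal frame): at a maximal Type-I Clay blow-up, for EVERY
`κ < 1` and every `t₀ ∈ [0, T)`,
`∬_{[t₀,T) × {|u|² > κν/(T−t)}} √(T − t) [‖ω × u‖² − κν|ω|²/(T − t)]₊ dx dt = ∞`:
ON ITS SUPER-`√κ`-SELF-SIMILAR SET THE FLUID CROSSES ITS OWN VORTEX LINES AT SUPER-`√κ`-SELF-SIMILAR RATE, IN INFINITE
`√(T − t)`-WEIGHTED MEASURE.  PROVED (`divergentSharpCrossFlow_holds`). -/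
def DivergentSharpCrossFlow : Prop :=
  ∀ (ν T : ℝ), 0 < ν → 0 < T → ∀ (u : ℝ → E3 → E3) (p : ℝ → E3 → ℝ),
    IsMaximalSmoothSolution ν 0 u p T → IsLerayHopfOn T ν 0 (u 0) u →
    HasRapidSpatialDecay (u 0) → IsTypeIBlowup u T →
    ∀ κ : ℝ, κ < 1 → ∀ t₀ : ℝ, 0 ≤ t₀ → t₀ < T → ∫⁻ z, xfsIntegrand T ν κ t₀ u z = ⊤

/-- **Residual SHARP SLACK** (maximal frame): every maximal Type-I Clay blow-up has, for some `κ < 1` and `t₀`, a finite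
sharp cross-flow number.  DECLARED ≡ row F1 (`sharpSlack_iff_rowF1`); no movement on `Row_F1` is claimed. -/
@[conjecture] def SharpSlack : Prop :=
  ∀ (ν T : ℝ), 0 < ν → 0 < T → ∀ (u : ℝ → E3 → E3) (p : ℝ → E3 → ℝ),
    IsMaximalSmoothSolution ν 0 u p T → IsLerayHopfOn T ν 0 (u 0) u →
    HasRapidSpatialDecay (u 0) → IsTypeIBlowup u T →
    ∃ κ t₀ : ℝ, κ < 1 ∧ 0 ≤ t₀ ∧ t₀ < T ∧ ∫⁻ z, xfsIntegrand T ν κ t₀ u z < ⊤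

/-- **THE ROUTE'S SPLIT THROUGH THE SHARP ROW**: `Row_F1sharp → SharpSlack → Row_F1` (by cases on extendability). -/
theorem rowF1_of_sharp (hX : Row_F1xfS) (hR : SharpSlack) : ScenarioCensus.Row_F1 := by
  unfold ScenarioCensus.Row_F1
  intro ν T hν hT u p hsol hLH hdec hTI
  by_contra hext
  obtain ⟨κ, t₀, hκ, ht₀, ht₀T, hfin⟩ := hR ν T hν hT u p ⟨hsol, hext⟩ hLH hdec hTI
  exact hext (hX ν T hν hT u p hsol hLH hdec hTI ⟨κ, t₀, hκ, ht₀, ht₀T, hfin⟩)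

/-- `Row_F1` ⇒ the sharp slack (vacuously). -/
theorem sharpSlack_of_rowF1 (h : ScenarioCensus.Row_F1) : SharpSlack :=
  fun ν T hν hT u p hmax hLH hdec hTI => (hmax.2 (h ν T hν hT u p hmax.1 hLH hdec hTI)).elim

/-- The sharp number is antitone in `κ` (fraction AND level move together). -/
theorem xfsIntegrand_anti {κ₁ κ₂ : ℝ} (hκ : κ₁ ≤ κ₂) {T ν : ℝ} (hν : 0 ≤ ν) (t₀ : ℝ) (u : ℝ → E3 → E3)
    (z : ℝ × E3) : xfsIntegrand T ν κ₂ t₀ u z ≤ xfsIntegrand T ν κ₁ t₀ u z :=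
  xflIntegrand_anti hκ hν (fun _ ht => critLevel_mono hκ hν ht) t₀ u z

/-- **Criterion row F1xf♯ is EXCLUDED** (in kernel): reduce to `κ₊ = max κ 0` by antitonicity, then the sharp socket with
the admissible (`isAdmissible_xflOf`), speed-dominated (`isSpeedDominated_xflOf`) read-out `xflOf κ₊` and the imported
cross-flow kill `kills_xflOf`. -/
theorem rowF1xfS_holds : Row_F1xfS := by
  intro ν T hν hT u p hsol hLH hdec hTI htop
  obtain ⟨κ, t₀, hκ, ht₀, ht₀T, hfinP⟩ := htop
  have hκ' : max κ 0 < 1 := max_lt hκ zero_lt_one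
  have hfin : ∫⁻ z, topIntegrandτ T ν t₀ (critLevel T ν (max κ 0)) (xflOf (max κ 0)) u z < ⊤ := by
    rw [lintegral_topIntegrandτ_xflOf_eq hν]
    refine ENNReal.mul_lt_top ENNReal.ofReal_lt_top (lt_of_le_of_lt ?_ hfinP)
    exact lintegral_mono fun z => xfsIntegrand_anti (le_max_left κ 0) hν.le t₀ u z
  exact sharpRowOf_of_kills (le_max_right κ 0) (isAdmissible_xflOf (max κ 0)) (isSpeedDominated_xflOf le_rfl)
    (kills_xflOf hκ') ν T hν hT u p hsol hLH hdec hTI ⟨t₀, ht₀, ht₀T, hfin⟩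

/-- **The floor DIVERGENT SHARP CROSS-FLOW holds.** -/
theorem divergentSharpCrossFlow_holds : DivergentSharpCrossFlow := by
  intro ν T hν hT u p hmax hLH hdec hTI κ hκ t₀ ht₀ ht₀T
  by_contra hne
  exact hmax.2 (rowF1xfS_holds ν T hν hT u p hmax.1 hLH hdec hTI
    ⟨κ, t₀, hκ, ht₀, ht₀T, lt_top_iff_ne_top.2 hne⟩)

/-- **The residual is EXACTLY `Row_F1`** (declared). -/
theorem sharpSlack_iff_rowF1 : SharpSlack ↔ ScenarioCensus.Row_F1 :=
  ⟨rowF1_of_sharp rowF1xfS_holds, sharpSlack_of_rowF1⟩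

/-- `SharpSlack → Row_F1` (the residual alone decides the row, the criterion row being proved). -/
theorem rowF1_of_sharpSlack (h : SharpSlack) : ScenarioCensus.Row_F1 := rowF1_of_sharp rowF1xfS_holds h

/-- **F1xf♯ ⇒ F1xf (LINE 28 SHARPENS LINE 27)**: a subcritical level eventually lies BELOW every critical level with
positive fraction, so the sharp number on a late window is dominated by LINE 27's number: the sharp hypothesis is WEAKER,
the sharp row STRONGER.  (The converse is not claimed.) -/
theorem rowF1xf_of_rowF1xfS (h : Row_F1xfS) : Row_F1xf := by
  intro ν T hν hT u p hsol hLH hdec hTI htop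
  obtain ⟨κ, t₀, Λ, hκ, ht₀, ht₀T, hΛ, hΛm, hfinP⟩ := htop
  -- the fraction `κ₂ = max κ (1/2) ∈ (0, 1)`
  have hκ₂ : max κ (1 / 2) < 1 := max_lt hκ (by norm_num)
  have hκ₂pos : 0 < max κ (1 / 2) := lt_of_lt_of_le (by norm_num) (le_max_right κ (1 / 2))
  -- a late window on which `Λ(t) √(T − t) < √(κ₂ ν)`
  have hc : 0 < Real.sqrt (max κ (1 / 2) * ν) := Real.sqrt_pos.2 (mul_pos hκ₂pos hν)
  have hev : ∀ᶠ t in 𝓝[<] T, Λ t * Real.sqrt (T - t) < Real.sqrt (max κ (1 / 2) * ν) :=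
    hΛ.eventually (gt_mem_nhds hc)
  obtain ⟨l, hlT, hl⟩ := mem_nhdsLT_iff_exists_Ioo_subset.1 hev
  have hlT' : l < T := hlT
  set t₁ : ℝ := max t₀ ((l + T) / 2) with ht₁
  have ht₁0 : 0 ≤ t₁ := ht₀.trans (le_max_left _ _)
  have ht₁T : t₁ < T := max_lt ht₀T (by linarith)
  have ht₀₁ : t₀ ≤ t₁ := le_max_left _ _
  have hlt₁ : l < t₁ := lt_of_lt_of_le (by linarith) (le_max_right _ _)
  refine h ν T hν hT u p hsol hLH hdec hTI ⟨max κ (1 / 2), t₁, hκ₂, ht₁0, ht₁T, lt_of_le_of_lt ?_ hfinP⟩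
  refine lintegral_mono fun z => ?_
  unfold xfsIntegrand xflIntegrand
  by_cases hz : z ∈ {z : ℝ × E3 | z.1 ∈ Ico t₁ T ∧ critLevel T ν (max κ (1 / 2)) z.1 < ‖u z.1 z.2‖}
  · have hzT : z.1 < T := hz.1.2
    have hσ : 0 < T - z.1 := sub_pos.2 hzT
    have hzl : z.1 ∈ Ioo l T := ⟨hlt₁.trans_le hz.1.1, hzT⟩
    have hΛz : Λ z.1 * Real.sqrt (T - z.1) < Real.sqrt (max κ (1 / 2) * ν) := hl hzl
    -- `Λ(z.1) < Λ♯(z.1) = √(κ₂ν) / √(T − z.1)`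
    have hsq : 0 < Real.sqrt (T - z.1) := Real.sqrt_pos.2 hσ
    have hcrit : critLevel T ν (max κ (1 / 2)) z.1 = Real.sqrt (max κ (1 / 2) * ν) / Real.sqrt (T - z.1) := by
      unfold critLevel
      rw [← mul_assoc, Real.sqrt_mul (mul_pos hκ₂pos hν).le, Real.sqrt_inv]
      exact (div_eq_mul_inv _ _).symm
    have hΛlt : Λ z.1 < critLevel T ν (max κ (1 / 2)) z.1 := by
      rw [hcrit, lt_div_iff₀ hsq]
      exact hΛz
    have hz' : z ∈ {z : ℝ × E3 | z.1 ∈ Ico t₀ T ∧ Λ z.1 < ‖u z.1 z.2‖} :=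
      ⟨⟨ht₀₁.trans hz.1.1, hzT⟩, hΛlt.trans hz.2⟩
    rw [indicator_of_mem hz, indicator_of_mem hz']
    refine ENNReal.ofReal_le_ofReal (mul_le_mul_of_nonneg_left (max_le_max le_rfl ?_) (Real.sqrt_nonneg _))
    have h0 : 0 ≤ ν * (T - z.1)⁻¹ * ‖curl (u z.1) z.2‖ ^ 2 :=
      mul_nonneg (mul_nonneg hν.le (inv_nonneg.2 hσ.le)) (sq_nonneg _)
    nlinarith [le_max_left κ (1 / 2)]
  · rw [indicator_of_notMem hz]
    exact bot_le

-- `rowF1xf_holds'`: a second proof term for LINE 27's `Row_F1xf` (statement identical to the landed `LiouvilleSocket.rowF1xf_holds`, gate lint dedup.landed); not re-declared — the route F1xf♯ ⇒ F1xf is `rowF1xf_of_rowF1xfS`.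

/-! ### Pointwise corners of the sharp row -/

/-- **SLOW CROSS-FLOW WHERE FAST** (the eventual pointwise corner of F1xf♯): Type I + for some `κ < 1` and `t₀ ∈ [0, T)`,
at every point of `[t₀, T) × ℝ³` where the speed exceeds `√κ` times the self-similar speed the fluid crosses its own
vortex lines slower than `√κ` times the self-similar rate (`κν/(T − t) < |u|² ⇒ ‖ω × u‖² ≤ κν|ω|²/(T − t)`) ⇒ smooth
extension.  Nothing is asked at slower points. -/
theorem rowF1_slowCrossFlowWhereFast : ∀ (ν T : ℝ), 0 < ν → 0 < T → ∀ (u : ℝ → E3 → E3) (p : ℝ → E3 → ℝ),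
    IsClassicalNSSolutionOn (Ico 0 T) ν 0 u p → IsLerayHopfOn T ν 0 (u 0) u →
    HasRapidSpatialDecay (u 0) → IsTypeIBlowup u T →
    (∃ κ t₀ : ℝ, κ < 1 ∧ 0 ≤ t₀ ∧ t₀ < T ∧
      ∀ t ∈ Ico t₀ T, ∀ x, κ * (ν * (T - t)⁻¹) < ‖u t x‖ ^ 2 →
        ‖cross (curl (u t) x) (u t x)‖ ^ 2 ≤ κ * (ν * (T - t)⁻¹ * ‖curl (u t) x‖ ^ 2)) →
    HasSmoothExtensionPast ν 0 u T := by
  intro ν T hν hT u p hsol hLH hdec hTI h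
  obtain ⟨κ, t₀, hκ, ht₀, ht₀T, hb⟩ := h
  -- reduce to `κ₊` (the hypothesis only gets weaker... no: we use the row at `κ` directly when `0 ≤ κ`,
  -- and at negative `κ` every point is fast, so the hypothesis is the LINE 27 all-points one)
  refine rowF1xfS_holds ν T hν hT u p hsol hLH hdec hTI ⟨κ, t₀, hκ, ht₀, ht₀T, ?_⟩
  have h0 : ∀ z, xfsIntegrand T ν κ t₀ u z = 0 := by
    intro z
    unfold xfsIntegrand xflIntegrand
    by_cases hz : z ∈ {z : ℝ × E3 | z.1 ∈ Ico t₀ T ∧ critLevel T ν κ z.1 < ‖u z.1 z.2‖}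
    · rw [indicator_of_mem hz]
      have hσ : 0 < T - z.1 := sub_pos.2 hz.1.2
      have hfast : κ * (ν * (T - z.1)⁻¹) < ‖u z.1 z.2‖ ^ 2 := by
        by_cases hk : 0 ≤ κ
        · exact (critLevel_lt_norm_iff hk hν.le hz.1.2 _).1 hz.2
        · have h1 : κ * (ν * (T - z.1)⁻¹) < 0 :=
            mul_neg_of_neg_of_pos (not_le.1 hk) (mul_pos hν (inv_pos.2 hσ))
          linarith [sq_nonneg ‖u z.1 z.2‖]
      have hle : ‖cross (curl (u z.1) z.2) (u z.1 z.2)‖ ^ 2 -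
          κ * (ν * (T - z.1)⁻¹ * ‖curl (u z.1) z.2‖ ^ 2) ≤ 0 := by
        linarith [hb z.1 hz.1 z.2 hfast]
      rw [max_eq_left hle, mul_zero, ENNReal.ofReal_zero]
    · rw [indicator_of_notMem hz]
  rw [lintegral_congr h0, lintegral_zero]
  exact ENNReal.zero_lt_top

/-- **NEAR-BELTRAMI WHERE FAST, FIXED ANGLE** (corner of F1xf♯; compare LINE 27's `rowF1_nearBeltramiTop` and census
F14′): a Type-I(M) Clay blow-up whose fluid keeps `‖ω × u‖ ≤ a |ω| |u|` with a FIXED `a < 1/M` AT THE POINTS WHERE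
`|u|² > (aM)² ν/(T − t)` (only there) on `[t₀, T)` cannot occur. -/
theorem rowF1_nearBeltramiWhereFast : ∀ (ν T : ℝ), 0 < ν → 0 < T → ∀ (u : ℝ → E3 → E3) (p : ℝ → E3 → ℝ),
    IsClassicalNSSolutionOn (Ico 0 T) ν 0 u p → IsLerayHopfOn T ν 0 (u 0) u →
    HasRapidSpatialDecay (u 0) →
    (∃ M a t₀ : ℝ, 0 ≤ a ∧ a * M < 1 ∧ 0 ≤ t₀ ∧ t₀ < T ∧
      (∀ t ∈ Ico t₀ T, ∀ x, Real.sqrt (T - t) * ‖u t x‖ ≤ M * Real.sqrt ν) ∧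
      ∀ t ∈ Ico t₀ T, ∀ x, (a * M) ^ 2 * (ν * (T - t)⁻¹) < ‖u t x‖ ^ 2 →
        ‖cross (curl (u t) x) (u t x)‖ ≤ a * (‖curl (u t) x‖ * ‖u t x‖)) →
    HasSmoothExtensionPast ν 0 u T := by
  intro ν T hν hT u p hsol hLH hdec h
  obtain ⟨M, a, t₀, ha, haM, ht₀, ht₀T, hTI, hang⟩ := h
  have hM0 : 0 ≤ M := by
    by_contra hneg
    have h1 := hTI t₀ ⟨le_rfl, ht₀T⟩ 0
    have h2 : M * Real.sqrt ν < 0 := mul_neg_of_neg_of_pos (not_le.1 hneg) (Real.sqrt_pos.2 hν)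
    linarith [mul_nonneg (Real.sqrt_nonneg (T - t₀)) (norm_nonneg (u t₀ 0))]
  have hTI' : IsTypeIBlowup u T := by
    refine (IsTypeIBlowupWith.isTypeIBlowup (M := M) (ν := ν) ?_)
    exact mem_nhdsLT_iff_exists_Ioo_subset.2 ⟨t₀, ht₀T, fun t ht x => hTI t ⟨ht.1.le, ht.2⟩ x⟩
  refine rowF1_slowCrossFlowWhereFast ν T hν hT u p hsol hLH hdec hTI'
    ⟨(a * M) ^ 2, t₀, pow_lt_one₀ (mul_nonneg ha hM0) haM two_ne_zero, ht₀, ht₀T, fun t ht x _hx => ?_⟩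
  have hσ : 0 < T - t := sub_pos.2 ht.2
  have hs : 0 < Real.sqrt (T - t) := Real.sqrt_pos.2 hσ
  have hub : ‖u t x‖ ≤ M * Real.sqrt ν / Real.sqrt (T - t) := by
    rw [le_div_iff₀ hs, mul_comm]; exact hTI t ht x
  have hMν : 0 ≤ M * Real.sqrt ν := le_trans (mul_nonneg hs.le (norm_nonneg _)) (hTI t ht x)
  have h1 := hang t ht x _hx
  have h2 : ‖cross (curl (u t) x) (u t x)‖ ≤ a * ‖curl (u t) x‖ * (M * Real.sqrt ν / Real.sqrt (T - t)) := by
    calc ‖cross (curl (u t) x) (u t x)‖ ≤ a * (‖curl (u t) x‖ * ‖u t x‖) := h1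
      _ = a * ‖curl (u t) x‖ * ‖u t x‖ := by ring
      _ ≤ a * ‖curl (u t) x‖ * (M * Real.sqrt ν / Real.sqrt (T - t)) :=
          mul_le_mul_of_nonneg_left hub (mul_nonneg ha (norm_nonneg _))
  have h4 : ‖cross (curl (u t) x) (u t x)‖ ^ 2 ≤ (a * ‖curl (u t) x‖ * (M * Real.sqrt ν / Real.sqrt (T - t))) ^ 2 :=
    pow_le_pow_left₀ (norm_nonneg _) h2 2
  have h5 : (a * ‖curl (u t) x‖ * (M * Real.sqrt ν / Real.sqrt (T - t))) ^ 2 =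
      (a * M) ^ 2 * (ν * (T - t)⁻¹ * ‖curl (u t) x‖ ^ 2) := by
    rw [mul_pow, mul_pow, div_pow, mul_pow, Real.sq_sqrt hν.le, Real.sq_sqrt hσ.le]
    field_simp
  rw [h5] at h4
  exact h4

end Summit.NavierStokesRegularity.NavierStokesRegularity.Theorems.ScenarioCensus.SharpTop

namespace Summit.NavierStokesRegularity.NavierStokesRegularity.Theorems.ScenarioCensus

/-! ## Census KEYS (ns `…Theorems.ScenarioCensus`): the SHARP-TOP member of row F1 — TREE-decided F1xf♯ (`Row_F1xfS`) and floor DSX -/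

/-- **Cell F1xf♯** (row F1 frame VERBATIM + for some `κ < 1`, `t₀ ∈ [0,T)`: the cross-flow excess over `√κ`× the self-similar rate is integrable ON THE CRITICAL FAST SET `{|u|² > κν/(T−t)}` — no level function ⇒ smooth extension past `T`): `:= SharpTop.Row_F1xfS`. DECIDED. -/
def Row_F1xfS : Prop := SharpTop.Row_F1xfS
/-- F1xfS is EXCLUDED (decided in the tree): `SharpTop.rowF1xfS_holds`. -/
theorem row_F1xfS_excluded : Row_F1xfS := SharpTop.rowF1xfS_holds

/-- **Floor DSX — DIVERGENT SHARP CROSS-FLOW** at the level of the census keys: `SharpTop.divergentSharpCrossFlow_holds`. -/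
theorem row_F1_divergentSharpCrossFlow : SharpTop.DivergentSharpCrossFlow := SharpTop.divergentSharpCrossFlow_holds
/-- Lattice edge at key level: F1xf♯ ⇒ F1xf (`SharpTop.rowF1xf_of_rowF1xfS`). -/
theorem rowF1xf_of_rowF1xfS : Row_F1xfS → Row_F1xf := SharpTop.rowF1xf_of_rowF1xfS

end Summit.NavierStokesRegularity.NavierStokesRegularity.Theorems.ScenarioCensus

end
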